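import Summits.ValiantsHypothesis.ValiantsHypothesis.Theorems.KPlusLogSqLawTropicalBTightnessThreshold
import Summits.ValiantsHypothesis.ValiantsHypothesis.Theorems.KPlusLogSqLawTropicalBIteratedHalving
import Literature.Computability.AlgebraicComplexity.KV20NonRigidEquationsProofs

/-!
# Route «KPlusLogSqLaw», crux `TropicalB` (stmt-ValiantsHypothesis-19771) — the counting-tightness threshold is FINITE and at most LINEAR:
# `κ(m) < 16m` for every `m ≥ 2` (halving), with the small-size ceilings `κ(3) ≤ 7`, `κ(4) ≤ 8`, `κ(5) ≤ 9`, `κ(6) ≤ 10`, `κ(7) ≤ 11`, `κ(8) ≤ 12`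

HONEST FRAMING.  Second companion of `…TropicalBTightnessThreshold` (seat val-sym-trop-p4 g12, cell `pub-symmetroid`, 2026-08-28;
`--supports stmt-ValiantsHypothesis-19771 --as helper`), toward the registered stubs `stub_tropThin` / `stub_tropFat` of
`Cruxes/TropicalB/Lines/birth.lean`.  UNCONDITIONAL census bookkeeping: the tree's iterated-halving rows (`IteratedHalving.tropRowD_four_pow`:
`T_D(m,K) ≤ 4^(m−1)·K − 1`, and the exact halving rows `15K−10`, `48K−31`, `190K−121`, `600K−381`, `2205K−1401`, `6720K−4271` for
`m = 3, …, 8`, val-sym-trop-p4 g6) are compared with the slope-counting ceiling `multichoose K m = C(m+K−1, m)`; wherever halving is the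
smaller, the format is not counting-tight, and by `Tightness.tropRowD_notTight_mono` neither is any larger `K`.  All of this lives in the
super-fat corner `K ≳ m`, OFF the crux window; nothing here bears on `TropicalB` in its window, `WeakLifting`, DoorA26 / DoorA34,
`MatrixDescartes` (stmt-ValiantsHypothesis-18050) or VP ≠ VNP.

CONTENT (`κ(m)` = the largest `K` at which some format-`(m, K)` design has a dominant chain through all `C(m+K−1, m)` class multisets;
`(m, K)` is tight exactly for `2 ≤ K ≤ κ(m)` by the companion file).
* `tropRowD_notTight_of_four_pow` — `4^(m−1)·K + 1 ≤ multichoose K m ⇒ TropRowD m K (multichoose K m − 2)` (not tight).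
* `two_mul_le_four_pow`, `tropRowD_notTight_of_sixteen_mul` — **for `m ≥ 2` and `K ≥ 16m` the format `(m, K)` is not counting-tight**:
  `κ(m) < 16m` unconditionally (`(⌊(K−1)/m⌋ + 1)^m ≤ multichoose K m` by the tree's `KumarVolk2020.succ_pow_le_choose`, and
  `4^(m−1)K + 1 ≤ 2·4^(m−1)K ≤ 16^(m−1)·(K/m)·… ≤ q^m` with `q = ⌊(K−1)/m⌋ + 1 ≥ 16`).
* the exact-row ceilings `three_row_notTight` (`K ≥ 8`), `four_row_notTight` (`K ≥ 9`), `five_row_notTight` (`K ≥ 10`), `six_row_notTight`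
  (`K ≥ 11`), `seven_row_notTight` (`K ≥ 12`), `eight_row_notTight` (`K ≥ 13`): base case = the halving row at the first `K` where it drops
  below counting, then propagation in `K`.

READING (located, not claimed).  With the companion files the threshold is now framed on three sides in the kernel: `κ(m) ≥ 3` for all `m`
(SHIFT-THREE-PLUS), `κ(2) = 4`, `κ(3) ∈ [4, 7]`, `κ(4) ∈ [4, 8]`, `κ(5) ≤ 9`, …, `κ(m) < 16m`; and `TropicalB ⇒ κ(m) < C₀·log₂ m`
(`…TightnessThresholdLog`).  Halving cannot do better than linear (it is blind to `K` beyond a factor), so every logarithmic ceiling on `κ`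
is crux-strength information; the census cells that move the picture are `(3,5)` (kernel non-tightness would give `κ(3) = 4`), `(5,4)`,
`(4,5)`.  [this file; arithmetic over the cited tree rows]
-/

set_option linter.dupNamespace false
set_option autoImplicit false

namespace Summit.ValiantsHypothesis.ValiantsHypothesis.Theorems.KPlusLogSqLaw

open Summit.ValiantsHypothesis.ValiantsHypothesis.Theorems.MatrixDescartes.Negative
open Summit.ValiantsHypothesis.ValiantsHypothesis.Theorems.LacunarySymmetroidMatrixDescartes
open Summit.ValiantsHypothesis.ValiantsHypothesis.Theorems.LacunarySymmetroidMatrixDescartes.TropicalCensus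
open scoped BigOperators
open Finset

namespace Tightness

variable {m K : ℕ}

/-- Halving versus counting: if `4^(m−1)·K + 1 ≤ multichoose K m` then no design of format `(m, K)` is counting-tight. -/
theorem tropRowD_notTight_of_four_pow (h : 4 ^ (m - 1) * K + 1 ≤ Nat.multichoose K m) :
    TropRowD m K (Nat.multichoose K m - 2) :=
  tropRowD_mono (by omega) (IteratedHalving.tropRowD_four_pow m K)

/-- `2m ≤ 4^(m−1)` for `m ≥ 2`. [arithmetic] -/
theorem two_mul_le_four_pow {m : ℕ} (hm : 2 ≤ m) : 2 * m ≤ 4 ^ (m - 1) := by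
  induction m, hm using Nat.le_induction with
  | base => norm_num
  | succ m hm ih =>
    have h4 : 4 ^ (m + 1 - 1) = 4 * 4 ^ (m - 1) := by
      rw [show m + 1 - 1 = (m - 1) + 1 by omega, pow_succ]; ring
    rw [h4]
    have : 1 ≤ 4 ^ (m - 1) := Nat.one_le_pow _ _ (by norm_num)
    omega

/-- **`κ(m) < 16m`: for `m ≥ 2` and `K ≥ 16m` the format `(m, K)` is not counting-tight** (halving beats counting there). -/
theorem tropRowD_notTight_of_sixteen_mul (hm : 2 ≤ m) (hK : 16 * m ≤ K) : TropRowD m K (Nat.multichoose K m - 2) := by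
  apply tropRowD_notTight_of_four_pow
  -- `q = ⌊(K−1)/m⌋ + 1` satisfies `q ≥ 16`, `K ≤ q·m` and `q^m ≤ multichoose K m`
  set n := (K - 1) / m with hn
  have hm0 : 0 < m := by omega
  have hq16 : 16 ≤ n + 1 := by
    have : 15 ≤ n := by
      rw [hn, Nat.le_div_iff_mul_le hm0]
      omega
    omega
  have hqm : K ≤ (n + 1) * m := by
    have h1 : K - 1 < n * m + m := by rw [hn]; exact Nat.lt_div_mul_add hm0
    have e : (n + 1) * m = n * m + m := by ring
    rw [e]
    omega
  have hchoose : (n + 1) ^ m ≤ Nat.multichoose K m := by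
    have h := Literature.Computability.AlgebraicComplexity.KumarVolk2020.succ_pow_le_choose n m (K - 1)
      (by rw [hn]; exact Nat.div_mul_le_self (K - 1) m)
    rw [Nat.multichoose_eq]
    have e : K + m - 1 = K - 1 + m := by omega
    rw [e]
    exact h
  obtain ⟨m', rfl⟩ : ∃ m', m = m' + 1 := ⟨m - 1, by omega⟩
  simp only [Nat.add_sub_cancel] at *
  have h2m : 2 * (m' + 1) ≤ 4 ^ m' := by
    have := two_mul_le_four_pow (m := m' + 1) hm
    simpa using this
  have h16 : 16 ^ m' ≤ (n + 1) ^ m' := Nat.pow_le_pow_left hq16 m'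
  calc 4 ^ m' * K + 1 ≤ 4 ^ m' * K + 4 ^ m' * K := by
        have : 0 < 4 ^ m' * K := Nat.mul_pos (by positivity) (by omega)
        omega
    _ = 4 ^ m' * (2 * K) := by ring
    _ ≤ 4 ^ m' * (2 * ((n + 1) * (m' + 1))) := Nat.mul_le_mul_left _ (Nat.mul_le_mul_left _ hqm)
    _ = (4 ^ m' * (2 * (m' + 1))) * (n + 1) := by ring
    _ ≤ (4 ^ m' * 4 ^ m') * (n + 1) := Nat.mul_le_mul_right _ (Nat.mul_le_mul_left _ h2m)
    _ = 16 ^ m' * (n + 1) := by rw [← mul_pow]; norm_num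
    _ ≤ (n + 1) ^ m' * (n + 1) := Nat.mul_le_mul_right _ h16
    _ = (n + 1) ^ (m' + 1) := by rw [pow_succ]
    _ ≤ Nat.multichoose K (m' + 1) := hchoose

/-! ### The exact halving rows `m = 3, …, 8` against counting -/

/-- `κ(3) ≤ 7`: for `K ≥ 8` the size-3 row `15K − 10` is below `C(K+2,3) − 2`, so `(3, K)` is not counting-tight. -/
theorem three_row_notTight (hK : 8 ≤ K) : TropRowD 3 K (Nat.multichoose K 3 - 2) :=
  tropRowD_notTight_mono (m := 3) (by norm_num) hK
    (tropRowD_mono (by rw [Nat.multichoose_eq]; decide) (IteratedHalving.tropRowD_three_row 8))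

/-- `κ(4) ≤ 8`: for `K ≥ 9` the size-4 row `48K − 31` is below `C(K+3,4) − 2`. -/
theorem four_row_notTight (hK : 9 ≤ K) : TropRowD 4 K (Nat.multichoose K 4 - 2) :=
  tropRowD_notTight_mono (m := 4) (by norm_num) hK
    (tropRowD_mono (by rw [Nat.multichoose_eq]; decide) (IteratedHalving.tropRowD_four_row 9))

/-- `κ(5) ≤ 9`: for `K ≥ 10` the size-5 row `190K − 121` is below `C(K+4,5) − 2`. -/
theorem five_row_notTight (hK : 10 ≤ K) : TropRowD 5 K (Nat.multichoose K 5 - 2) :=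
  tropRowD_notTight_mono (m := 5) (by norm_num) hK
    (tropRowD_mono (by rw [Nat.multichoose_eq]; decide) (IteratedHalving.tropRowD_five_row 10))

/-- `κ(6) ≤ 10`: for `K ≥ 11` the size-6 row `600K − 381` is below `C(K+5,6) − 2`. -/
theorem six_row_notTight (hK : 11 ≤ K) : TropRowD 6 K (Nat.multichoose K 6 - 2) :=
  tropRowD_notTight_mono (m := 6) (by norm_num) hK
    (tropRowD_mono (by rw [Nat.multichoose_eq]; decide) (IteratedHalving.tropRowD_six_row 11))

/-- `κ(7) ≤ 11`: for `K ≥ 12` the size-7 row `2205K − 1401` is below `C(K+6,7) − 2`. -/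
theorem seven_row_notTight (hK : 12 ≤ K) : TropRowD 7 K (Nat.multichoose K 7 - 2) :=
  tropRowD_notTight_mono (m := 7) (by norm_num) hK
    (tropRowD_mono (by rw [Nat.multichoose_eq]; decide) (IteratedHalving.tropRowD_seven_row 12))

/-- `κ(8) ≤ 12`: for `K ≥ 13` the size-8 row `6720K − 4271` is below `C(K+7,8) − 2`. -/
theorem eight_row_notTight (hK : 13 ≤ K) : TropRowD 8 K (Nat.multichoose K 8 - 2) :=
  tropRowD_notTight_mono (m := 8) (by norm_num) hK
    (tropRowD_mono (by rw [Nat.multichoose_eq]; decide) (IteratedHalving.tropRowD_eight_row 13))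

end Tightness

end Summit.ValiantsHypothesis.ValiantsHypothesis.Theorems.KPlusLogSqLaw
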